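import Summits.QuantumFields.YangMills.Theorems.AlphaInputsT3ACv3ChargedGlueX
import Summits.QuantumFields.YangMills.Theorems.AlphaInputsT3ACv3RegionProp2
import HarnessLib

/-!
# `AlphaInputsT3ACv3InnerLiftFine` — STRATEGY B for 2′: THE INNER EXACT LIFT (EL) OF THE SEAM-BLIND CLASS REDUCED TO **FINE REGULARITY UNDER `Ω_k(h)`**:
# an exact `k`-fold (0.4)-lift of the datum whose FINEST plaquettes under `Ω_k(h)` are within `α·L^{−2k}` of `1` is an inner lift — r3 on
# `plaqsIn s Ω_k(h)` for every `s ≤ k` and the small loop variables at the bonds of `Ω_k(h)` follow from the REGIONAL Prop. 2 and the two-block Stokes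
# bound — lane `pub-balaban3d`, seat alpha-2 (g4)

WHY (HOME `D6R-SEAMS-alpha2-g4.md` §3, `D6X-GLUE-alpha2-g4.md` §5).  After the free-seam glue (`…v3ChargedGlueX.adaptedClassNonemptyChargedT3X_of_innerLift`) the
W-dependent residual of the charged non-emptiness row is (EL) `InnerExactLiftT3`: at every admissible `(k, h)` and charged `W` an `InnerLiftT3 k h W U` — (i) δ/2-small (0.4) loop
variables of `(blockAvg ℰp)^i U` at the bonds of `Ω_k(h)` of levels `1 … k`, (ii) `(blockAvg ℰp)^k U = W` on `bondsIn k Ω_k(h)`, (iii) r3: the level-`s` plaquettes inside `Ω_k(h)`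
of `(blockAvg ℰp)^s U` within `C68·θ(K−k)·L^{−2(k−s)}`.  Print's object behind it is [B11] Thm 1's space (8): a configuration with exact averages whose FINE plaquettes on the region are
within `B₃ε₁L^{−2k}`; (i) and (iii) are then CONSEQUENCES of [B7] Props. 1–2 with print's locality.  THIS FILE proves exactly that, with the tree's tools landed by this seat:
* §1 the region `Ω_k(h)` as a NESTED family of coarse-site sets `R s := {z | toFine s z ∈ Ω_k(h)}` (`z ∈ R s ↔ blockOf z ∈ R (s+1)`: block saturation `mem_Omega_iff_of_coarsen_eq`);
  `plaqsIn s Ω_k(h)` = the level-`s` plaquettes with four corners in `R s`.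
* §2 ★ `dist1_iter_lt_of_fineRegular_T3`: fine plaquettes with four corners under `Ω_k(h)` within `α·L^{−2k}` (`C₀(3)α ≤ ⅓`, `2α ≤ c′₂`) ⇒ every level-`s` plaquette inside `Ω_k(h)`
  of the `s`-fold average within `2α·(L^s/L^k)²` (`…v3RegionProp2.dist1_iter_blockAvg_lt_region`).
* §3 ★ `dist1_loopHol_iter_le_of_fineRegular_T3`: the loop variables at the bonds of `Ω_k(h)` (levels `1 … k`) within `(((d+2)L)²/4)·2α` (`…v3BoxStokes.dist1_loopHol_le_twoBlock`:
  the plaquettes of the two blocks of a bond of `Ω_k(h)` lie inside `Ω_k(h)`).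
* §4 ★★ `innerLiftT3_of_fineRegular`: top42 ∧ fine regularity under `Ω_k(h)` with `2α ≤ C68·θ(K−k)` and `25L²·2α/4 ≤ δ/2` ⇒ `InnerLiftT3`; the displayed hypothesis
  **(FL) `InnerFineLiftsT3`** (∀ admissible charged `(k,h,W)`: ∃ U with exact `k`-fold averages `W` on `bondsIn k Ω_k(h)` and fine plaquettes under `Ω_k(h)` `< B·ε_W·L^{−2k}`,
  `ε_W = 2L²·avgWindowFactor·θ(K−k+1)` the window of `ChargedT3`) and ★★ `innerExactLiftT3_of_fineLifts : InnerFineLiftsT3 → (sizes) → InnerExactLiftT3` — (EL) ⇐ (FL), the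
  non-emptiness of [B11] (8) for the region `Ω_k(h)` with free boundary (LOCATED special case of Thm 1 (8) p.279's existence clause; print states it for [B10] §A's nested sequences).
HONEST FRAMING.  (FL) is displayed (hypothesis schema, never asserted); nothing of [B10]∕[7]∕[4]'s estimates asserted beyond the tree's PROVED [B7] Props. 1–2 for (0.4); count-neutral
helper toward R3 2′ (`stub_laneRecordsV3`, items 19935∕19936); registry untouched; nothing about d = 4, the continuum, or a mass gap.

References: T. Bałaban, Commun. Math. Phys. 102 (1985) 277–309 [Balaban1985Variational] ((2), (8) pp.278–279, (11)–(13) pp.279–280); CMP 98 (1985) 17–51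
[Balaban1985Averaging] (Props. 1–2 (51)–(54) p.26); CMP 102 (1985) 255–275 [Balaban1985UV3] ((40)–(42) p.266, (68) p.273).
-/

set_option autoImplicit false

noncomputable section

namespace Summit.QuantumFields.YangMills.Theorems

open MeasureTheory Set
open scoped Matrix.Norms.L2Operator
open Literature.MathematicalPhysics.QuantumFieldTheory.Balaban1983to89
open Literature.MathematicalPhysics.QuantumFieldTheory.Balaban1983to89.T3ContinuumYM3Torus
open Literature.MathematicalPhysics.QuantumFieldTheory.Balaban1983to89.T3UnitLawDensityEML (ℰp)
open Literature.MathematicalPhysics.QuantumFieldTheory.Balaban1983to89.T3UnitScaleTilt (θBal)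
open Literature.MathematicalPhysics.QuantumFieldTheory.Balaban1983to89.ExpMeanLog (deltaSU)
open Literature.MathematicalPhysics.QuantumFieldTheory.Balaban1983to89.B10Eq38TorusDomains (plaqsIn mem_plaqsIn_iff cornerSet toFine toFine_succ)
open Literature.MathematicalPhysics.QuantumFieldTheory.Balaban1983to89.B10Eq42TorusConstraint (bondsIn mem_bondsIn_iff lam42 lam42_self)
open Literature.MathematicalPhysics.QuantumFieldTheory.Balaban1985CMP102.Setting
open Summit.QuantumFields.Balaban3D.Carriers
open Summit.QuantumFields.Balaban3D.Proofs.Primitives (AlphaConsts)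
open Summit.QuantumFields.YangMills.Theorems.BoxStokes (dist1_iter_blockAvg_lt_region dist1_loopHol_le_twoBlock blockOf_mem_pair_iff walkEnd_single_mem_pi)

section T3

variable {F : T3Family} {𝔠 : AlphaConsts F.L (suGroupModel 2).N} {γ : ℝ} {hγ : 0 < γ} {hγ1 : γ ≤ (min 𝔠.gamma0 1) ^ 2} {K : ℕ}

/-! ## §1 `Ω_k(h)` as a nested family of coarse-site sets; `plaqsIn` read through it -/

/-- **`Ω_k(h)` IS A UNION OF BLOCKS OF EVERY LEVEL `≤ k`, NESTED FORM**: for `s < k ≤ K` a level-`s` site has its representative in `Ω_k(h)` iff its block's representative does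
(`mem_Omega_iff_of_coarsen_eq`; both representatives share the `(s+1)`-block). [cite: Balaban1985UV3, (39) p.266] -/
theorem AlphaInputsT3AC.mem_under_Omega_iff_blockOf {k : ℕ} (hk : k ≤ K) (h : Hist (F.P K) k) {s : ℕ} (hs : s < k) (z : Site (F.P K) s) :
    toFine s z ∈ Omega 𝔠.lane.carrier.M₁ (rcolOf (T3Scales F γ hγ (hγ1.trans (sq_min_one_le _ 𝔠.gamma0_pos)) K) 𝔠.lane.carrier) k h k ↔
      toFine (s + 1) (blockOf z) ∈ Omega 𝔠.lane.carrier.M₁ (rcolOf (T3Scales F γ hγ (hγ1.trans (sq_min_one_le _ 𝔠.gamma0_pos)) K) 𝔠.lane.carrier) k h k := by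
  have hs1 : s + 1 ≤ (F.P K).m + (F.P K).K := (Nat.succ_le_of_lt hs).trans (AlphaInputsT3AC.le_standing_of_le hk)
  have hs0 : s ≤ (F.P K).m + (F.P K).K := (Nat.le_succ s).trans hs1
  refine mem_Omega_iff_of_coarsen_eq _ _ h (Nat.succ_le_of_lt hs) le_rfl ?_
  rw [coarsen_succ, coarsen_toFine s hs0, coarsen_toFine (s + 1) hs1]

/-- A level-`s` plaquette lies in `plaqsIn s X` iff its four corners have their representatives in `X`. [cite: Balaban1985UV3, p.267] -/
theorem AlphaInputsT3AC.mem_plaqsIn_iff_corners {s : ℕ} {X : Set (Site (F.P K) 0)} {q : Plaq (F.P K) s} :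
    q ∈ plaqsIn s X ↔ toFine s q.src ∈ X ∧ toFine s (q.src.shift q.μ) ∈ X ∧ toFine s (q.src.shift q.ν) ∈ X ∧ toFine s ((q.src.shift q.μ).shift q.ν) ∈ X := by
  rw [mem_plaqsIn_iff]
  simp only [cornerSet, insert_subset_iff, singleton_subset_iff]

/-! ## §2 Fine regularity under `Ω_k(h)` ⇒ regularity of every `s`-fold average inside `Ω_k(h)` -/

/-- **★ FINE REGULARITY UNDER `Ω_k(h)` GIVES REGULAR `s`-FOLD AVERAGES INSIDE `Ω_k(h)`, UNIFORMLY IN `s ≤ k`** (`k ≤ K`): if every finest plaquette with its four corners in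
`Ω_k(h)` is within `α·L^{−2k}` of `1` (`C₀(3)α ≤ ⅓`, `2α ≤ c′₂(3, L)`), then every `q ∈ plaqsIn s Ω_k(h)` has `|((blockAvg ℰp)^s U)(∂q) − 1| < 2α·(L^s/L^k)²` — the regional Prop. 2 on the
nested family of §1. [cite: Balaban1985Averaging, Prop. 2 (52)–(54) p.26] -/
theorem AlphaInputsT3AC.dist1_iter_lt_of_fineRegular_T3 {k : ℕ} (hk : k ≤ K) (h : Hist (F.P K) k) {α : ℝ} (hα : 0 < α)
    (hα3 : (143 * ((((3 + 4 : ℕ) : ℝ)) ^ 2 / 4) ^ 2) * α ≤ 1 / 3) (hα2 : 2 * α ≤ 2 * deltaSU (Fin 2) / (((3 + 4) * F.L : ℕ) : ℝ) ^ 2)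
    {U : GaugeField (F.P K) 0 (Matrix.specialUnitaryGroup (Fin 2) ℂ)}
    (hreg : ∀ q : Plaq (F.P K) 0, q ∈ plaqsIn 0 (Omega 𝔠.lane.carrier.M₁
        (rcolOf (T3Scales F γ hγ (hγ1.trans (sq_min_one_le _ 𝔠.gamma0_pos)) K) 𝔠.lane.carrier) k h k) →
      GaugeGroup.dist1 (GaugeField.plaqHol U q) < α * (((F.L : ℝ) ^ k)⁻¹) ^ 2)
    {s : ℕ} (hs : s ≤ k) (q : Plaq (F.P K) s)
    (hq : q ∈ plaqsIn s (Omega 𝔠.lane.carrier.M₁ (rcolOf (T3Scales F γ hγ (hγ1.trans (sq_min_one_le _ 𝔠.gamma0_pos)) K) 𝔠.lane.carrier) k h k)) :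
    GaugeGroup.dist1 (GaugeField.plaqHol (Averaging.iter (fun l => BlockAveraging.blockAvg (P := F.P K) (j := l) ℰp) s U) q) <
      2 * α * ((F.L : ℝ) ^ s * ((F.L : ℝ) ^ k)⁻¹) ^ 2 := by
  set Ω : Set (Site (F.P K) 0) := Omega 𝔠.lane.carrier.M₁ (rcolOf (T3Scales F γ hγ (hγ1.trans (sq_min_one_le _ 𝔠.gamma0_pos)) K) 𝔠.lane.carrier) k h k
    with hΩ
  obtain ⟨h1, h2, h3, h4⟩ := AlphaInputsT3AC.mem_plaqsIn_iff_corners.1 hq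
  exact dist1_iter_blockAvg_lt_region (n := Fin 2) (P := F.P K) k (AlphaInputsT3AC.le_standing_of_le hk) hα hα3 hα2
    (fun i => {z : Site (F.P K) i | toFine i z ∈ Ω}) (fun i hi z => AlphaInputsT3AC.mem_under_Omega_iff_blockOf (hγ := hγ) (hγ1 := hγ1) hk h hi z)
    (fun q' h1' h2' h3' h4' => hreg q' (AlphaInputsT3AC.mem_plaqsIn_iff_corners.2 ⟨h1', h2', h3', h4'⟩)) hs q h1 h2 h3 h4

/-- `(L^s · (L^k)⁻¹)² = ((L^{k−s})⁻¹)²` for `s ≤ k`. [folklore] -/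
theorem AlphaInputsT3AC.pow_ratio_sq_eq (L : ℝ) (hL : 0 < L) {s k : ℕ} (hs : s ≤ k) :
    (L ^ s * (L ^ k)⁻¹) ^ 2 = ((L ^ (k - s))⁻¹) ^ 2 := by
  congr 1
  have hk : L ^ k = L ^ s * L ^ (k - s) := by rw [← pow_add, Nat.add_sub_cancel' hs]
  rw [hk, mul_inv, ← mul_assoc, mul_inv_cancel₀ (pow_ne_zero _ hL.ne'), one_mul]

/-! ## §3 Fine regularity under `Ω_k(h)` ⇒ small loop variables at the bonds of `Ω_k(h)` -/

/-- In the two-block product set of a coarse bond, the lower-left and upper-right corners of a plaquette control the other two (coordinate mixing). [folklore] -/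
theorem AlphaInputsT3AC.blockOf_corners_mem_pair {P : Params} {j : ℕ} (c : PBond P (j + 1)) (q : Plaq P j)
    (h1 : blockOf q.src = c.src ∨ blockOf q.src = c.tgt)
    (h2 : blockOf ((q.src.shift q.μ).shift q.ν) = c.src ∨ blockOf ((q.src.shift q.μ).shift q.ν) = c.tgt) :
    (blockOf (q.src.shift q.μ) = c.src ∨ blockOf (q.src.shift q.μ) = c.tgt) ∧ (blockOf (q.src.shift q.ν) = c.src ∨ blockOf (q.src.shift q.ν) = c.tgt) := by
  have hne : ((q.μ, true) : T4Continuum.Letter P.d).1 ≠ ((q.ν, true) : T4Continuum.Letter P.d).1 := ne_of_lt q.hμν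
  have e1 : q.src.shift q.μ = T4Continuum.walkEnd q.src [(q.μ, true)] := rfl
  have e2 : q.src.shift q.ν = T4Continuum.walkEnd q.src [(q.ν, true)] := rfl
  have e3 : (q.src.shift q.μ).shift q.ν = T4Continuum.walkEnd q.src [(q.μ, true), (q.ν, true)] := rfl
  rw [e3] at h2
  obtain ⟨hμ', hν'⟩ := walkEnd_single_mem_pi hne ((blockOf_mem_pair_iff c _).1 h1) ((blockOf_mem_pair_iff c _).1 h2)
  rw [e1, e2]
  exact ⟨(blockOf_mem_pair_iff c _).2 hμ', (blockOf_mem_pair_iff c _).2 hν'⟩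

/-- **★ FINE REGULARITY UNDER `Ω_k(h)` GIVES SMALL (0.4) LOOP VARIABLES AT THE BONDS OF `Ω_k(h)` OF EVERY LEVEL `i + 1 ≤ k`**: the loops at a bond `c ∈ bondsIn (i+1) Ω_k(h)` live in
the two blocks of `c`, whose level-`i` plaquettes lie inside `Ω_k(h)` (§1) and are within `2α(L^i/L^k)² ≤ 2α` (§2); `…v3BoxStokes.dist1_loopHol_le_twoBlock`.
[cite: Balaban1987RG1, (0.4) p.253; Balaban1985Averaging, (19)–(20) p.21] -/
theorem AlphaInputsT3AC.dist1_loopHol_iter_le_of_fineRegular_T3 {k : ℕ} (hk : k ≤ K) (h : Hist (F.P K) k) {α : ℝ} (hα : 0 < α)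
    (hα3 : (143 * ((((3 + 4 : ℕ) : ℝ)) ^ 2 / 4) ^ 2) * α ≤ 1 / 3) (hα2 : 2 * α ≤ 2 * deltaSU (Fin 2) / (((3 + 4) * F.L : ℕ) : ℝ) ^ 2)
    {U : GaugeField (F.P K) 0 (Matrix.specialUnitaryGroup (Fin 2) ℂ)}
    (hreg : ∀ q : Plaq (F.P K) 0, q ∈ plaqsIn 0 (Omega 𝔠.lane.carrier.M₁
        (rcolOf (T3Scales F γ hγ (hγ1.trans (sq_min_one_le _ 𝔠.gamma0_pos)) K) 𝔠.lane.carrier) k h k) →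
      GaugeGroup.dist1 (GaugeField.plaqHol U q) < α * (((F.L : ℝ) ^ k)⁻¹) ^ 2)
    {i : ℕ} (hi : i < k) (c : PBond (F.P K) (i + 1))
    (hc : c ∈ bondsIn (i + 1) (Omega 𝔠.lane.carrier.M₁ (rcolOf (T3Scales F γ hγ (hγ1.trans (sq_min_one_le _ 𝔠.gamma0_pos)) K) 𝔠.lane.carrier) k h k))
    (x : BlockAveraging.Idx (F.P K)) :
    GaugeGroup.dist1 (BlockAveraging.loopHol (Averaging.iter (fun j => (BlockAveraging.blockAvg ℰp : Averaging (F.P K) j _)) i U) c x) ≤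
      ((((3 + 2) * F.L : ℕ) : ℝ) ^ 2 / 4) * (2 * α) := by
  set Ω : Set (Site (F.P K) 0) := Omega 𝔠.lane.carrier.M₁ (rcolOf (T3Scales F γ hγ (hγ1.trans (sq_min_one_le _ 𝔠.gamma0_pos)) K) 𝔠.lane.carrier) k h k
    with hΩ
  have hi1 : i + 1 ≤ (F.P K).m + (F.P K).K := (Nat.succ_le_of_lt hi).trans (AlphaInputsT3AC.le_standing_of_le hk)
  have hL : (0 : ℝ) < F.L := by exact_mod_cast (zero_lt_one.trans F.hL.2)
  -- the endpoints of `c` are under `Ω_k(h)`; hence so is every level-`i` site of their blocks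
  have hsrc : toFine (i + 1) c.src ∈ Ω := hc.1
  have htgt : toFine (i + 1) c.tgt ∈ Ω := hc.2
  have hunder : ∀ z : Site (F.P K) i, (blockOf z = c.src ∨ blockOf z = c.tgt) → toFine i z ∈ Ω := by
    intro z hz
    have key := (AlphaInputsT3AC.mem_under_Omega_iff_blockOf (hγ := hγ) (hγ1 := hγ1) hk h hi z).2
    rcases hz with hz | hz
    · exact key (by rw [hz]; exact hsrc)
    · exact key (by rw [hz]; exact htgt)
  -- the plaquettes of the two blocks are inside `Ω_k(h)`, within `2α(L^i/L^k)² ≤ 2α`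
  have hx1 : ((F.L : ℝ) ^ i * ((F.L : ℝ) ^ k)⁻¹) ^ 2 ≤ 1 := by
    have hLk : (0 : ℝ) < (F.L : ℝ) ^ k := by positivity
    have hik : (F.L : ℝ) ^ i * ((F.L : ℝ) ^ k)⁻¹ ≤ 1 := by
      rw [mul_inv_le_iff₀ hLk, one_mul]
      exact pow_le_pow_right₀ (by exact_mod_cast F.hL.2.le) hi.le
    have h0 : 0 ≤ (F.L : ℝ) ^ i * ((F.L : ℝ) ^ k)⁻¹ := by positivity
    nlinarith
  refine dist1_loopHol_le_twoBlock hi1 (by positivity) c (fun q hq1 hq2 => ?_) x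
  obtain ⟨hqμ, hqν⟩ := AlphaInputsT3AC.blockOf_corners_mem_pair c q hq1 hq2
  have hq : q ∈ plaqsIn i Ω :=
    AlphaInputsT3AC.mem_plaqsIn_iff_corners.2 ⟨hunder _ hq1, hunder _ hqμ, hunder _ hqν, hunder _ hq2⟩
  have hlt := AlphaInputsT3AC.dist1_iter_lt_of_fineRegular_T3 (hγ := hγ) (hγ1 := hγ1) hk h hα hα3 hα2 hreg hi.le q hq
  have : 2 * α * ((F.L : ℝ) ^ i * ((F.L : ℝ) ^ k)⁻¹) ^ 2 ≤ 2 * α := by nlinarith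
  exact hlt.le.trans this

/-! ## §4 (EL) from fine regularity: the inner lift, and the displayed hypothesis (FL) -/

/-- **★★ AN EXACT `k`-FOLD LIFT OF `W` ON `Ω_k(h)` WITH FINE REGULARITY UNDER `Ω_k(h)` IS AN INNER LIFT** (`k ≤ K`): `U ∈ top42Set k h W` and every finest plaquette with four corners in
`Ω_k(h)` within `α·L^{−2k}`, where `C₀(3)α ≤ ⅓`, `2α ≤ c′₂(3, L)`, `(5L)²·2α/4 ≤ δ/2` and `2α ≤ C68·θ(K−k)`, give `InnerLiftT3 k h W U` — r3 inside `Ω_k(h)` by §2, the small loop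
variables by §3. [cite: Balaban1985Variational, (2)+(8) pp.278–279; Balaban1985UV3, (42) p.266 + (68) p.273; Balaban1985Averaging, Props. 1–2 p.26] -/
theorem AlphaInputsT3AC.innerLiftT3_of_fineRegular {k : ℕ} (hk : k ≤ K) (h : Hist (F.P K) k)
    (W : GaugeField (F.P K) k (Matrix.specialUnitaryGroup (Fin 2) ℂ)) {U : GaugeField (F.P K) 0 (Matrix.specialUnitaryGroup (Fin 2) ℂ)}
    (htop : U ∈ AlphaInputsT3AC.top42Set F 𝔠 γ hγ hγ1 K k h W) {α : ℝ} (hα : 0 < α)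
    (hα3 : (143 * ((((3 + 4 : ℕ) : ℝ)) ^ 2 / 4) ^ 2) * α ≤ 1 / 3) (hα2 : 2 * α ≤ 2 * deltaSU (Fin 2) / (((3 + 4) * F.L : ℕ) : ℝ) ^ 2)
    (hloop : ((((3 + 2) * F.L : ℕ) : ℝ) ^ 2 / 4) * (2 * α) ≤ ℰp.δ / 2) (hbud : 2 * α ≤ 𝔠.C68 * θBal F.L γ 𝔠.b₀ 𝔠.p₀ (K - k))
    (hreg : ∀ q : Plaq (F.P K) 0, q ∈ plaqsIn 0 (Omega 𝔠.lane.carrier.M₁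
        (rcolOf (T3Scales F γ hγ (hγ1.trans (sq_min_one_le _ 𝔠.gamma0_pos)) K) 𝔠.lane.carrier) k h k) →
      GaugeGroup.dist1 (GaugeField.plaqHol U q) < α * (((F.L : ℝ) ^ k)⁻¹) ^ 2) :
    AlphaInputsT3AC.InnerLiftT3 F 𝔠 γ hγ hγ1 K k h W U := by
  have hL : (0 : ℝ) < F.L := by exact_mod_cast (zero_lt_one.trans F.hL.2)
  refine ⟨fun i hi c hc x => ?_, htop, fun s hs q hq => ?_⟩
  · rw [lam42_self] at hc
    exact (AlphaInputsT3AC.dist1_loopHol_iter_le_of_fineRegular_T3 (hγ := hγ) (hγ1 := hγ1) hk h hα hα3 hα2 hreg hi c hc x).trans hloop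
  · rw [lam42_self] at hq
    have hlt := AlphaInputsT3AC.dist1_iter_lt_of_fineRegular_T3 (hγ := hγ) (hγ1 := hγ1) hk h hα hα3 hα2 hreg hs q hq
    rw [AlphaInputsT3AC.pow_ratio_sq_eq _ hL hs] at hlt
    refine hlt.le.trans ?_
    have h0 : 0 ≤ (((F.L : ℝ) ^ (k - s))⁻¹) ^ 2 := by positivity
    exact mul_le_mul_of_nonneg_right hbud h0

variable (F 𝔠 γ hγ hγ1 K)

/-- **(FL) — INNER EXACT LIFTS WITH FINE REGULARITY EXIST** (hypothesis schema, kinematic, never asserted): for every `k ≤ K`, every admissible non-trivial history and every CHARGED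
datum `W`, some finest-lattice field has EXACT `k`-fold `blockAvg ℰp`-averages `W` on `bondsIn k Ω_k(h)` and every finest plaquette with four corners in `Ω_k(h)` within
`B·(2L²·avgWindowFactor·θ(K−k+1))·L^{−2k}` of `1` — the non-emptiness of [Balaban1985Variational]'s space (8) `𝔘_k({Ω_k(h)}, B₃ε₁) ∩ 𝔅_k(W)` for the one region `Ω_k(h)` with free boundary
(print: Thm 1 (8) p.279, existence clause, stated for the nested domain sequences of [B10] §A — the region∕free-boundary case is a LOCATED specialisation), the datum's window being that of
`ChargedT3`.  `B` plays the rôle of print's `B₃`. [cite: Balaban1985Variational, (2)+(8) pp.278–279] -/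
def AlphaInputsT3AC.InnerFineLiftsT3 (B : ℝ) : Prop :=
  ∀ (k : ℕ), k ≤ K → ∀ (h : Hist (F.P K) k),
    Hist.Admissible 𝔠.lane.carrier.M₁ (rcolOf (T3Scales F γ hγ (hγ1.trans (sq_min_one_le _ 𝔠.gamma0_pos)) K) 𝔠.lane.carrier) k h →
    h ≠ Hist.triv (F.P K) k → ∀ (W : GaugeField (F.P K) k (Matrix.specialUnitaryGroup (Fin 2) ℂ)),
      ChargedT3 F γ 𝔠.b₀ 𝔠.p₀ (avgWindowFactor F.L) K 𝔠.lane.carrier.M₁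
        (rcolOf (T3Scales F γ hγ (hγ1.trans (sq_min_one_le _ 𝔠.gamma0_pos)) K) 𝔠.lane.carrier) k h W →
      ∃ U : GaugeField (F.P K) 0 (Matrix.specialUnitaryGroup (Fin 2) ℂ),
        U ∈ AlphaInputsT3AC.top42Set F 𝔠 γ hγ hγ1 K k h W ∧
        ∀ q : Plaq (F.P K) 0, q ∈ plaqsIn 0 (Omega 𝔠.lane.carrier.M₁
            (rcolOf (T3Scales F γ hγ (hγ1.trans (sq_min_one_le _ 𝔠.gamma0_pos)) K) 𝔠.lane.carrier) k h k) →
          GaugeGroup.dist1 (GaugeField.plaqHol U q) <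
            B * (2 * (F.L : ℝ) ^ 2 * avgWindowFactor F.L * θBal F.L γ 𝔠.b₀ 𝔠.p₀ (K - k + 1)) * (((F.L : ℝ) ^ k)⁻¹) ^ 2

variable {F 𝔠 γ hγ hγ1 K}

/-- **★★ (EL) ⇐ (FL) UNDER THE RECORD'S SIZE CONDITIONS**: with `α := B·ε_W(k)`, `ε_W(k) = 2L²·avgWindowFactor·θ(K−k+1)`, the four conditions of `innerLiftT3_of_fineRegular` are
`C₀(3)·B·ε_W ≤ ⅓`, `2Bε_W ≤ c′₂(3,L)`, `(5L)²·2Bε_W/4 ≤ δ/2` (smallness of the window — all implied by the record's `a₁`-smallness rows at every `k ≤ K` once `ε_W(k) ≤ 2B₃a₁`-type bounds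
hold; kept EXPLICIT here as hypotheses quantified over `k`) and the BUDGET `2B·ε_W(k) ≤ C68·θ(K−k)` (from `4B₃L²·avgWindowFactor ≤ C68` and `θ` antitone when `B ≤ B₃`).
[cite: Balaban1985Variational, Thm 1 (8) p.279; Balaban1985UV3, (40)–(42) p.266 + (68) p.273] -/
theorem AlphaInputsT3AC.innerExactLiftT3_of_fineLifts {B : ℝ} (hB : 0 < B) (hFL : AlphaInputsT3AC.InnerFineLiftsT3 F 𝔠 γ hγ hγ1 K B)
    (hwin : ∀ k, k ≤ K →
      0 < θBal F.L γ 𝔠.b₀ 𝔠.p₀ (K - k + 1) ∧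
      (143 * ((((3 + 4 : ℕ) : ℝ)) ^ 2 / 4) ^ 2) * (B * (2 * (F.L : ℝ) ^ 2 * avgWindowFactor F.L * θBal F.L γ 𝔠.b₀ 𝔠.p₀ (K - k + 1))) ≤ 1 / 3 ∧
      2 * (B * (2 * (F.L : ℝ) ^ 2 * avgWindowFactor F.L * θBal F.L γ 𝔠.b₀ 𝔠.p₀ (K - k + 1))) ≤ 2 * deltaSU (Fin 2) / (((3 + 4) * F.L : ℕ) : ℝ) ^ 2 ∧
      ((((3 + 2) * F.L : ℕ) : ℝ) ^ 2 / 4) * (2 * (B * (2 * (F.L : ℝ) ^ 2 * avgWindowFactor F.L * θBal F.L γ 𝔠.b₀ 𝔠.p₀ (K - k + 1)))) ≤ ℰp.δ / 2 ∧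
      2 * (B * (2 * (F.L : ℝ) ^ 2 * avgWindowFactor F.L * θBal F.L γ 𝔠.b₀ 𝔠.p₀ (K - k + 1))) ≤ 𝔠.C68 * θBal F.L γ 𝔠.b₀ 𝔠.p₀ (K - k)) :
    AlphaInputsT3AC.InnerExactLiftT3 F 𝔠 γ hγ hγ1 K := by
  intro k hk h hh ht W hW
  obtain ⟨U, htop, hreg⟩ := hFL k hk h hh ht W hW
  obtain ⟨hθ, h3, h2, hl, hb⟩ := hwin k hk
  have hα : 0 < B * (2 * (F.L : ℝ) ^ 2 * avgWindowFactor F.L * θBal F.L γ 𝔠.b₀ 𝔠.p₀ (K - k + 1)) := by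
    have hL : (0 : ℝ) < F.L := by exact_mod_cast (zero_lt_one.trans F.hL.2)
    have hA : 0 < avgWindowFactor F.L := by unfold avgWindowFactor; positivity
    positivity
  exact ⟨U, AlphaInputsT3AC.innerLiftT3_of_fineRegular (hγ := hγ) (hγ1 := hγ1) hk h W htop hα h3 h2 hl hb hreg⟩

end T3

end Summit.QuantumFields.YangMills.Theorems

end
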